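import Mathlib.Topology.Subpath
import Literature.AlgebraicGeometry.Motives.FamiliesVHS
import HarnessLib

/-!
# Geometric VHS data pinned to the Gauss–Manin system by tube restrictions

`GeometricVHSData B f n i` (file `FamiliesVHS`) is a *hypothesis structure*: a VHS datum `D` on
`S(ℂ)` with identifications `D.fiberIso s : V_s ≃ Hⁱ(𝒳_s)` whose only constraint tying parallel
transport to the topology of `f : 𝒳 ⟶ S` is `transport_restrict` (restrictions of GLOBAL classes
are flat). That is invariant under re-decorating `fiberIso s` by automorphisms of `Hⁱ(𝒳_s)` fixing
the image of `Hⁱ(𝒳)`, so it does not pin `(D.V, fiberIso)` to the local system `Rⁱ f(ℂ)_* ℚ`.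
This file supplies the missing predicate and its first consequences (all proved).

* `fiberTube f V ⊆ 𝒳(ℂ)`: the **tube** `T_V` over `V ⊆ S(ℂ)`, the union of the images of the
  fibres `𝒳_t(ℂ) → 𝒳(ℂ)`, `t ∈ V` (`= f(ℂ)⁻¹ V`, `fiberTube_eq_preimage`, i.e. the set
  `HodgeTheory.tubeOver f V`; the present form is the one inlined in route statements);
  `toFiberTube`, the **tube restriction** `fiberTubeRestrict f ht i : Hⁱ(T_V; ℚ) ⟶ Hⁱ(𝒳_t(ℂ); ℚ)`,
  `restrictToFiberTube` and `restrictToFiberTube_comp_fiberTubeRestrict`.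
* `GeometricVHSData.bettiTransport D γ : Hⁱ(𝒳_t(ℂ); ℚ) →ₗ Hⁱ(𝒳_{t'}(ℂ); ℚ)`: `D`'s transport
  conjugated by `fiberIso` and `B.isoObj`; `bettiTransport_refl/_trans`, `bettiTransport_map_fiberι`
  (global classes are flat), `isHodgeAt_transport_iff`.
* `GeometricVHSData.IsGaussManinOn D V`: for `t, t' ∈ V` and every path `γ` from `t` to `t'` inside
  `V`, (i) `res_t : Hⁱ(T_V; ℚ) → Hⁱ(𝒳_t(ℂ); ℚ)` is onto and (ii) `bettiTransport ⟦γ⟧ (res_t ξ) =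
  res_{t'} ξ` for all `ξ`; `GeometricVHSData.IsGaussManin D`: every `t₀ ∈ S(ℂ)` has a neighbourhood
  `V` with `D.IsGaussManinOn V` — Ehresmann's theorem read in cohomology: over a small contractible
  `V`, `Hⁱ(T_V, A) ≅ Hⁱ(X_t, A)` by restriction, and the stalks of `Rⁱ f_* A` are the `Hⁱ(X_t, A)`
  by restriction (Voisin, *Hodge Theory I*, Thm. 9.3, §9.2.1; *II*, §3.1.2; Deligne, *Hodge II*,
  4.1.1). `isGaussManin_iff` is, by `Iff.rfl`, the fully inlined clause of the route statements.
* `IsGaussManinOn.surjective/bettiTransport_fiberTubeRestrict/ker_le_ker/exists_eq_fiberTubeRestrict`;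
  the **subdivision principle** `IsGaussManin.pathInduction` (a property of homotopy classes of
  paths stable under concatenation and true inside the sets `V` holds for all paths: Lebesgue
  number + `Path.subpath`, Voisin II §3.1.2 "gluing local trivialisations above segments
  `[εᵢ, εᵢ₊₁]`"), and **rigidity** `IsGaussManin.eq_bettiTransport`: a functorial transport on the
  `Hⁱ(𝒳_t(ℂ); ℚ)` compatible with tube restrictions over the sets `V` equals `D.bettiTransport` on
  every path (so `(D.V, fiberIso)` is conjugate to the honest Gauss–Manin system once available).

## What is NOT here

* "The Gauss–Manin datum of a smooth projective family over a smooth base is Gauss–Manin"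
  (Ehresmann): that datum is not constructed in the tree as a `GeometricVHSData` (`Rⁱ f_* ℤ`,
  comparison with `B`, flat polarizations); its `ℂ`-coefficient topological half is
  `HodgeTheory.IsCohomologicallyLocallyTrivialOn` / `transportFun_fiberRestrict`. No named fact here.
* `IsGaussManinOn` is not monotone in `V` (clause (ii) over a smaller tube is not implied), whence
  one neighbourhood per point in `IsGaussManin`, exactly as inlined by the routes.

## References

* C. Voisin, *Hodge Theory and Complex Algebraic Geometry I* (2002), Thm. 9.3 (Ehresmann), §9.2.1
  (`Rᵏ π_* A` is a local system, stalk `≅ Hᵏ(X_t, A)` by restriction; Def. 9.13).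
* C. Voisin, *Hodge Theory and Complex Algebraic Geometry II* (2003), §3.1.1–§3.1.2.
* P. Deligne, *Théorie de Hodge II*, Publ. Math. IHÉS 40 (1971), 4.1.1.
* E. Cattani, P. Deligne, A. Kaplan, *On the locus of Hodge classes*, JAMS 8 (1995), §1.
-/

noncomputable section

open CategoryTheory AlgebraicGeometry Limits
open _root_.Topology
open Literature.AlgebraicTopology.SingularHomology

namespace Literature.AlgebraicGeometry.Motives

/-! ### Tubes over subsets of the base and restriction to fibres -/

section Tubes

variable {𝒳 S : SchemeOver ℂ} (f : 𝒳 ⟶ S)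

/-- The **tube** `T_V ⊆ 𝒳(ℂ)` over `V ⊆ S(ℂ)`: the complex points of `𝒳` lying on a fibre `𝒳_t`,
`t ∈ V`, i.e. the union of the images of `𝒳_t(ℂ) → 𝒳(ℂ)` for `t ∈ V` (as a type it carries the
subspace topology). It equals `f(ℂ)⁻¹ V` (`fiberTube_eq_preimage`); this presentation is the one
inlined in route statements (Voisin I, §9.2.1, `𝒳_U = π⁻¹(U)`). [folklore] -/
def fiberTube (V : Set (ComplexPoints S)) : Set (ComplexPoints 𝒳) :=
  {y | ∃ t ∈ V, ∃ x : ComplexPoints (fiberOver f t), AlgPoints.map (fiberι f t) x = y}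

variable {f} in
/-- Membership in the tube, unfolded. [folklore] -/
theorem mem_fiberTube_iff {V : Set (ComplexPoints S)} {y : ComplexPoints 𝒳} :
    y ∈ fiberTube f V ↔ ∃ t ∈ V, ∃ x : ComplexPoints (fiberOver f t), AlgPoints.map (fiberι f t) x = y :=
  Iff.rfl

/-- Points of the fibre `𝒳_t(ℂ)`, `t ∈ V`, lie in the tube over `V`. [folklore] -/
theorem map_fiberι_mem_fiberTube {V : Set (ComplexPoints S)} {t : ComplexPoints S} (ht : t ∈ V)
    (x : ComplexPoints (fiberOver f t)) : AlgPoints.map (fiberι f t) x ∈ fiberTube f V :=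
  ⟨t, ht, x, rfl⟩

/-- Every endomorphism of `Spec ℂ` over `Spec ℂ` is the identity (`AlgPoints.endSpecOver_eq_id` of
`HodgeTheory.HodgeLocus`, re-proved privately to keep the import cone at `FamiliesVHS`). [folklore] -/
private theorem endSpecOver_eq_id_aux (g : specOver ℂ ℂ ⟶ specOver ℂ ℂ) : g = 𝟙 _ := by
  have hid : (specOver ℂ ℂ).hom = 𝟙 (Spec (.of ℂ)) := by
    simp only [specOver, Over.mk_hom, Algebra.algebraMap_self, CommRingCat.ofHom_id, Spec.map_id]
  have h : g.left ≫ (specOver ℂ ℂ).hom = (specOver ℂ ℂ).hom := Over.w g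
  rw [hid] at h
  erw [Category.comp_id] at h
  apply Over.OverMorphism.ext
  exact h

/-- A point of `𝒳_t(ℂ)` maps to `t` under `𝒳_t ⟶ 𝒳 ⟶ S` (`AlgPoints.map_map_fiberι` of
`HodgeTheory.HodgeLocus`, re-proved privately; Hartshorne II.3). [folklore] -/
private theorem map_map_fiberι_aux (t : ComplexPoints S) (x : ComplexPoints (fiberOver f t)) :
    AlgPoints.map f (AlgPoints.map (fiberι f t) x) = t := by
  have h1 : AlgPoints.map (fiberOverToSpec f t) x = 𝟙 _ := endSpecOver_eq_id_aux _
  rw [← AlgPoints.map_comp_apply, fiberι_comp, AlgPoints.map_comp_apply, h1, AlgPoints.map_apply,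
    Category.id_comp]

/-- **The tube is the preimage of the base set**: `T_V = f(ℂ)⁻¹ V` (a point `y` with `f(y) = t`
lifts to the fibre product `𝒳 ×_S Spec ℂ` as `(y, 𝟙)`; Hartshorne II.3). In particular
`fiberTube f V` is the set `HodgeTheory.tubeOver f V`. [folklore] -/
theorem fiberTube_eq_preimage (V : Set (ComplexPoints S)) :
    fiberTube f V = AlgPoints.map f ⁻¹' V := by
  ext y
  simp only [mem_fiberTube_iff, Set.mem_preimage]
  constructor
  · rintro ⟨t, ht, x, rfl⟩
    rwa [map_map_fiberι_aux]
  · intro hy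
    have w : y.left ≫ f.left = 𝟙 _ ≫ (AlgPoints.map f y).left := by rw [Category.id_comp]; rfl
    refine ⟨AlgPoints.map f y, hy, Over.homMk (pullback.lift y.left (𝟙 _) w) ?_, ?_⟩
    · change pullback.lift y.left (𝟙 _) w ≫ (pullback.fst f.left (AlgPoints.map f y).left ≫ 𝒳.hom) = _
      rw [pullback.lift_fst_assoc]
      exact Over.w y
    · apply Over.OverMorphism.ext
      change pullback.lift y.left (𝟙 _) w ≫ pullback.fst f.left (AlgPoints.map f y).left = y.left
      exact pullback.lift_fst _ _ _

/-- The inclusion `𝒳_t(ℂ) → T_V` of a fibre into the tube, `t ∈ V`, as a continuous map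
(`AlgPoints.mapContinuous (fiberι f t)` corestricted). [folklore] -/
def toFiberTube {V : Set (ComplexPoints S)} {t : ComplexPoints S} (ht : t ∈ V) :
    C(ComplexPoints (fiberOver f t), fiberTube f V) :=
  ⟨fun x => ⟨AlgPoints.map (fiberι f t) x, t, ht, x, rfl⟩,
    (AlgPoints.mapContinuous (L := ℂ) (fiberι f t)).continuous.subtype_mk _⟩

/-- `toFiberTube` followed by the inclusion of the tube is `(fiberι f t)(ℂ)`. [folklore] -/
theorem val_comp_toFiberTube {V : Set (ComplexPoints S)} {t : ComplexPoints S} (ht : t ∈ V) :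
    (⟨Subtype.val, continuous_subtype_val⟩ : C(fiberTube f V, ComplexPoints 𝒳)).comp (toFiberTube f ht) =
      AlgPoints.mapContinuous (fiberι f t) :=
  rfl

/-- **Tube restriction** `res_t : Hⁱ(T_V; ℚ) ⟶ Hⁱ(𝒳_t(ℂ); ℚ)`, `t ∈ V`: pull-back along
`toFiberTube` (Voisin I, §9.2.1: "the stalk … at `t` is canonically isomorphic to `Hᵏ(X_t, A)` by
restriction"). [cite: VoisinHodgeI2002, §9.2.1] -/
def fiberTubeRestrict {V : Set (ComplexPoints S)} {t : ComplexPoints S} (ht : t ∈ V) (i : ℕ) :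
    singularCohomology ℚ ℚ (fiberTube f V) i ⟶ bettiCohomology (fiberOver f t) i :=
  singularCohomology.map ℚ ℚ (toFiberTube f ht) i

/-- Restriction `Hⁱ(𝒳(ℂ); ℚ) ⟶ Hⁱ(T_V; ℚ)` of global classes to a tube. [folklore] -/
def restrictToFiberTube (V : Set (ComplexPoints S)) (i : ℕ) :
    bettiCohomology 𝒳 i ⟶ singularCohomology ℚ ℚ (fiberTube f V) i :=
  singularCohomology.map ℚ ℚ (⟨Subtype.val, continuous_subtype_val⟩ : C(fiberTube f V, ComplexPoints 𝒳)) i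

/-- Restricting a global class to the tube and then to a fibre is `(fiberι f t)(ℂ)^*`. [folklore] -/
theorem restrictToFiberTube_comp_fiberTubeRestrict {V : Set (ComplexPoints S)} {t : ComplexPoints S}
    (ht : t ∈ V) (i : ℕ) :
    restrictToFiberTube f V i ≫ fiberTubeRestrict f ht i = bettiCohomology.map (fiberι f t) i := by
  rw [restrictToFiberTube, fiberTubeRestrict, ← singularCohomology.map_comp, val_comp_toFiberTube]

/-- Pointwise form of `restrictToFiberTube_comp_fiberTubeRestrict`. [folklore] -/
theorem fiberTubeRestrict_restrictToFiberTube_apply {V : Set (ComplexPoints S)} {t : ComplexPoints S}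
    (ht : t ∈ V) (i : ℕ) (y : bettiCohomology 𝒳 i) :
    (fiberTubeRestrict f ht i).hom ((restrictToFiberTube f V i).hom y) =
      (bettiCohomology.map (fiberι f t) i).hom y := by
  rw [← restrictToFiberTube_comp_fiberTubeRestrict f ht i, ModuleCat.hom_comp, LinearMap.comp_apply]

end Tubes

/-! ### Transport conjugated to Betti cohomology of the fibres -/

namespace GeometricVHSData

variable {B : BettiHodgeData ℂ} {𝒳 S : SchemeOver ℂ} {f : 𝒳 ⟶ S} {n i : ℕ}
  (D : GeometricVHSData B f n i)

/-- `D`'s parallel transport along `γ` **conjugated to Betti cohomology of the fibres**: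
`Hⁱ(𝒳_t(ℂ); ℚ) ≃ Hⁱ(𝒳_t) ≃ V_t → V_{t'} ≃ Hⁱ(𝒳_{t'}) ≃ Hⁱ(𝒳_{t'}(ℂ); ℚ)` through `B.isoObj` and
`D.fiberIso` (for the Gauss–Manin datum this is the monodromy/transport of `Rⁱ f_* ℚ`,
Voisin II, §3.1.2). [folklore] -/
def bettiTransport {t t' : ComplexPoints S} (γ : Path.Homotopic.Quotient t t') :
    bettiCohomology (fiberOver f t) i →ₗ[ℚ] bettiCohomology (fiberOver f t') i :=
  (B.isoObj (fiberOver f t') i).toLinearMap ∘ₗ (D.fiberIso t').toLinearMap ∘ₗ D.V.transport γ ∘ₗ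
    (D.fiberIso t).symm.toLinearMap ∘ₗ (B.isoObj (fiberOver f t) i).symm.toLinearMap

/-- `bettiTransport` unfolded. [folklore] -/
theorem bettiTransport_apply {t t' : ComplexPoints S} (γ : Path.Homotopic.Quotient t t')
    (x : bettiCohomology (fiberOver f t) i) :
    D.bettiTransport γ x = B.isoObj (fiberOver f t') i (D.fiberIso t'
      (D.V.transport γ ((D.fiberIso t).symm ((B.isoObj (fiberOver f t) i).symm x)))) :=
  rfl

/-- Conjugated transport along the constant path is the identity. [folklore] -/
@[simp]
theorem bettiTransport_refl (t : ComplexPoints S) :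
    D.bettiTransport (Path.Homotopic.Quotient.refl t) = LinearMap.id := by
  ext x
  simp [bettiTransport_apply]

/-- Conjugated transport is compatible with concatenation of paths. [folklore] -/
theorem bettiTransport_trans {t t' t'' : ComplexPoints S} (γ₁ : Path.Homotopic.Quotient t t')
    (γ₂ : Path.Homotopic.Quotient t' t'') :
    D.bettiTransport (γ₁.trans γ₂) = D.bettiTransport γ₂ ∘ₗ D.bettiTransport γ₁ := by
  ext x
  simp only [bettiTransport_apply, LinearMap.comp_apply, LocalSystem.transport_trans,
    LinearEquiv.symm_apply_apply]

/-- **Global classes are flat**: `bettiTransport γ (y|_{𝒳_t}) = y|_{𝒳_{t'}}` for `y ∈ Hⁱ(𝒳(ℂ); ℚ)`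
(from the field `transport_restrict`; Deligne, Hodge II, 4.1.1). [folklore] -/
theorem bettiTransport_map_fiberι {t t' : ComplexPoints S} (γ : Path.Homotopic.Quotient t t')
    (y : bettiCohomology 𝒳 i) :
    D.bettiTransport γ ((bettiCohomology.map (fiberι f t) i).hom y) =
      (bettiCohomology.map (fiberι f t') i).hom y := by
  obtain ⟨a, rfl⟩ := (B.isoObj 𝒳 i).surjective y
  have ht := B.isoObj_pullback (fiberι f t) i a
  have ht' := B.isoObj_pullback (fiberι f t') i a
  change _ = (bettiCohomology.map (fiberι f t) i).hom _ at ht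
  change _ = (bettiCohomology.map (fiberι f t') i).hom _ at ht'
  rw [← ht, ← ht', bettiTransport_apply, LinearEquiv.symm_apply_apply, ← restrict_apply,
    D.transport_restrict_apply, restrict_apply, LinearEquiv.apply_symm_apply]

/-- Transport of integral vectors read in Betti cohomology: `fiberIso (1 ⊗ γ_* u)` is
`isoObj⁻¹ (bettiTransport γ (isoObj (fiberIso (1 ⊗ u))))`. [folklore] -/
theorem fiberIso_toRat_transport {s t : ComplexPoints S} (γ : Path.Homotopic.Quotient s t)
    (u : D.VZ.fiber s) :
    D.fiberIso t (D.toRat t (D.VZ.transport γ u)) = (B.isoObj (fiberOver f t) i).symm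
      (D.bettiTransport γ (B.isoObj (fiberOver f s) i (D.fiberIso s (D.toRat s u)))) := by
  rw [← D.transport_toRat, bettiTransport_apply]
  simp only [LinearEquiv.symm_apply_apply]

/-- **The transported integral vector is a Hodge class iff the conjugated transport of its Betti
image is a Hodge class of `Hⁱ(𝒳_t)`** (`isHodgeAt_iff` after `fiberIso_toRat_transport`). [folklore] -/
theorem isHodgeAt_transport_iff {s t : ComplexPoints S} (γ : Path.Homotopic.Quotient s t) (p : ℤ)
    (u : D.VZ.fiber s) :
    D.IsHodgeAt t p (D.VZ.transport γ u) ↔ (B.isoObj (fiberOver f t) i).symm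
      (D.bettiTransport γ (B.isoObj (fiberOver f s) i (D.fiberIso s (D.toRat s u)))) ∈
        (B.hodge (D.isSmoothProjective_fiberOver t) i).hodgeClasses p := by
  rw [D.isHodgeAt_iff, fiberIso_toRat_transport]

/-! ### The Gauss–Manin predicate -/

/-- `D` **is Gauss–Manin over `V ⊆ S(ℂ)`**: for all `t, t' ∈ V` and every path `γ` from `t` to
`t'` inside `V`, (i) the tube restriction `res_t : Hⁱ(T_V; ℚ) → Hⁱ(𝒳_t(ℂ); ℚ)` is surjective and
(ii) `bettiTransport ⟦γ⟧ (res_t ξ) = res_{t'} ξ` for every tube class `ξ ∈ Hⁱ(T_V; ℚ)` —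
Ehresmann's local triviality read in cohomology: over a small contractible `V`,
`Hⁱ(T_V, A) ≅ Hⁱ(X_t, A)` by restriction and transport is `res_{t'} ∘ res_t⁻¹` (Voisin I, §9.2.1;
Voisin II, §3.1.2). Stated with `.hom` applications, literally as inlined by route statements.
[cite: VoisinHodgeI2002, §9.2.1 (with Thm. 9.3)] -/
def IsGaussManinOn (V : Set (ComplexPoints S)) : Prop :=
  ∀ (t : ComplexPoints S) (ht : t ∈ V) (t' : ComplexPoints S) (ht' : t' ∈ V) (γ : Path t t'),
    (∀ τ : unitInterval, γ τ ∈ V) →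
      Function.Surjective (fun x : singularCohomology ℚ ℚ (fiberTube f V) i =>
          (fiberTubeRestrict f ht i).hom x) ∧
        ∀ x : singularCohomology ℚ ℚ (fiberTube f V) i,
          D.bettiTransport ⟦γ⟧ ((fiberTubeRestrict f ht i).hom x) = (fiberTubeRestrict f ht' i).hom x

/-- `D` **is Gauss–Manin** (is the local system `Rⁱ f(ℂ)_* ℚ` up to conjugation by `fiberIso` and
`B.isoObj`): every `t₀ ∈ S(ℂ)` has a neighbourhood `V` with `D.IsGaussManinOn V`. For the
Gauss–Manin datum of a smooth projective family over a smooth base this is Ehresmann's theorem with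
homotopy invariance (Voisin I, Thm. 9.3, §9.2.1; Deligne, Hodge II, 4.1.1); here it is the
predicate singling out such data among all `GeometricVHSData`. [cite: VoisinHodgeI2002, §9.2.1] -/
def IsGaussManin (D : GeometricVHSData B f n i) : Prop :=
  ∀ t₀ : ComplexPoints S, ∃ V ∈ 𝓝 t₀, D.IsGaussManinOn V

/-- `D.IsGaussManin` is, by `Iff.rfl`, the clause inlined verbatim (with `i = 2p`) in the route
statements that requested it (tube as a subtype, restriction as `singularCohomology.map` of the
corestricted `AlgPoints.mapContinuous (fiberι f t)`). [folklore] -/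
theorem isGaussManin_iff : D.IsGaussManin ↔
    ∀ t₀ : ComplexPoints S, ∃ V ∈ 𝓝 t₀, ∀ (t : ComplexPoints S) (ht : t ∈ V) (t' : ComplexPoints S)
      (ht' : t' ∈ V) (γ : Path t t'), (∀ τ : unitInterval, γ τ ∈ V) →
      Function.Surjective (fun x : singularCohomology ℚ ℚ {y : ComplexPoints 𝒳 // ∃ t ∈ V,
          ∃ x : ComplexPoints (fiberOver f t), AlgPoints.map (fiberι f t) x = y} i =>
        (singularCohomology.map ℚ ℚ (⟨fun x => ⟨AlgPoints.map (fiberι f t) x, t, ht, x, rfl⟩,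
          (AlgPoints.mapContinuous (L := ℂ) (fiberι f t)).continuous.subtype_mk _⟩ :
          C(ComplexPoints (fiberOver f t), {y : ComplexPoints 𝒳 // ∃ t ∈ V,
            ∃ x : ComplexPoints (fiberOver f t), AlgPoints.map (fiberι f t) x = y})) i).hom x) ∧
      ∀ x : singularCohomology ℚ ℚ {y : ComplexPoints 𝒳 // ∃ t ∈ V,
          ∃ x : ComplexPoints (fiberOver f t), AlgPoints.map (fiberι f t) x = y} i,
        B.isoObj (fiberOver f t') i (D.fiberIso t' (D.V.transport ⟦γ⟧ ((D.fiberIso t).symm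
          ((B.isoObj (fiberOver f t) i).symm ((singularCohomology.map ℚ ℚ
            (⟨fun x => ⟨AlgPoints.map (fiberι f t) x, t, ht, x, rfl⟩,
              (AlgPoints.mapContinuous (L := ℂ) (fiberι f t)).continuous.subtype_mk _⟩ :
              C(ComplexPoints (fiberOver f t), {y : ComplexPoints 𝒳 // ∃ t ∈ V,
                ∃ x : ComplexPoints (fiberOver f t), AlgPoints.map (fiberι f t) x = y})) i).hom x))))) =
        (singularCohomology.map ℚ ℚ (⟨fun x => ⟨AlgPoints.map (fiberι f t') x, t', ht', x, rfl⟩,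
          (AlgPoints.mapContinuous (L := ℂ) (fiberι f t')).continuous.subtype_mk _⟩ :
          C(ComplexPoints (fiberOver f t'), {y : ComplexPoints 𝒳 // ∃ t ∈ V,
            ∃ x : ComplexPoints (fiberOver f t), AlgPoints.map (fiberι f t) x = y})) i).hom x :=
  Iff.rfl

variable {D}

/-- Clause (i): over a Gauss–Manin set, tube restriction to each fibre is surjective. [folklore] -/
theorem IsGaussManinOn.surjective {V : Set (ComplexPoints S)} (h : D.IsGaussManinOn V)
    {t : ComplexPoints S} (ht : t ∈ V) : Function.Surjective (fiberTubeRestrict f ht i).hom :=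
  (h t ht t ht (Path.refl t) fun _ => ht).1

/-- Clause (ii): along a path inside a Gauss–Manin set, conjugated transport carries `ξ|_{𝒳_t}` to
`ξ|_{𝒳_{t'}}` for every tube class `ξ`. [folklore] -/
theorem IsGaussManinOn.bettiTransport_fiberTubeRestrict {V : Set (ComplexPoints S)}
    (h : D.IsGaussManinOn V) {t t' : ComplexPoints S} (ht : t ∈ V) (ht' : t' ∈ V) (γ : Path t t')
    (hγ : ∀ τ, γ τ ∈ V) (ξ : singularCohomology ℚ ℚ (fiberTube f V) i) :
    D.bettiTransport ⟦γ⟧ ((fiberTubeRestrict f ht i).hom ξ) = (fiberTubeRestrict f ht' i).hom ξ :=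
  (h t ht t' ht' γ hγ).2 ξ

/-- Over a Gauss–Manin set, a tube class vanishing on one fibre vanishes on every fibre joined to
it inside the set (the kernels of the tube restrictions agree along paths). [folklore] -/
theorem IsGaussManinOn.ker_le_ker {V : Set (ComplexPoints S)} (h : D.IsGaussManinOn V)
    {t t' : ComplexPoints S} (ht : t ∈ V) (ht' : t' ∈ V) (γ : Path t t') (hγ : ∀ τ, γ τ ∈ V) :
    LinearMap.ker (fiberTubeRestrict f ht i).hom ≤ LinearMap.ker (fiberTubeRestrict f ht' i).hom := by
  intro ξ hξ
  rw [LinearMap.mem_ker, ← h.bettiTransport_fiberTubeRestrict ht ht' γ hγ ξ, LinearMap.mem_ker.1 hξ, map_zero]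

/-- Clauses (i)+(ii) combined: along a path inside a Gauss–Manin set, the conjugated transport of
any class `x ∈ Hⁱ(𝒳_t(ℂ); ℚ)` is `ξ|_{𝒳_{t'}}` for any tube class `ξ` with `ξ|_{𝒳_t} = x`
("transport is `res_{t'} ∘ res_t⁻¹`"). [folklore] -/
theorem IsGaussManinOn.exists_eq_fiberTubeRestrict {V : Set (ComplexPoints S)}
    (h : D.IsGaussManinOn V) {t t' : ComplexPoints S} (ht : t ∈ V) (ht' : t' ∈ V) (γ : Path t t')
    (hγ : ∀ τ, γ τ ∈ V) (x : bettiCohomology (fiberOver f t) i) :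
    ∃ ξ : singularCohomology ℚ ℚ (fiberTube f V) i, (fiberTubeRestrict f ht i).hom ξ = x ∧
      D.bettiTransport ⟦γ⟧ x = (fiberTubeRestrict f ht' i).hom ξ := by
  obtain ⟨ξ, rfl⟩ := h.surjective ht x
  exact ⟨ξ, rfl, h.bettiTransport_fiberTubeRestrict ht ht' γ hγ ξ⟩

/-- **Subdivision principle.** If `D` is Gauss–Manin, a property of homotopy classes of paths in
`S(ℂ)` which is stable under concatenation and holds for (the class of) every path running inside a
set over which `D` is Gauss–Manin holds for every path: cover the path by the neighbourhoods of
`IsGaussManin`, take a Lebesgue partition `0 = τ₀ ≤ … ≤ τₘ = 1` of `[0, 1]` and concatenate the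
subpaths `γ|[τₖ, τₖ₊₁]` (`Path.Homotopy.subpathTransSubpath`) — "gluing local trivialisations
above segments `[εᵢ, εᵢ₊₁]`" (Voisin II, §3.1.2). [cite: VoisinHodgeII2003, §3.1.2] -/
theorem IsGaussManin.pathInduction (hD : D.IsGaussManin)
    (P : ∀ t t' : ComplexPoints S, Path.Homotopic.Quotient t t' → Prop)
    (htrans : ∀ {t t' t'' : ComplexPoints S} (γ₁ : Path.Homotopic.Quotient t t')
      (γ₂ : Path.Homotopic.Quotient t' t''), P t t' γ₁ → P t' t'' γ₂ → P t t'' (γ₁.trans γ₂))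
    (hloc : ∀ ⦃V : Set (ComplexPoints S)⦄, D.IsGaussManinOn V →
      ∀ ⦃t t' : ComplexPoints S⦄ (γ : Path t t'), (∀ τ, γ τ ∈ V) → P t t' ⟦γ⟧)
    {t t' : ComplexPoints S} (γ : Path t t') : P t t' ⟦γ⟧ := by
  choose V hV hGM using fun r : unitInterval => hD (γ r)
  obtain ⟨τ, h0, hmono, ⟨m, hm⟩, hsub⟩ :=
    exists_monotone_Icc_subset_open_cover_unitInterval (c := fun r => γ ⁻¹' interior (V r))
      (fun r => isOpen_interior.preimage γ.continuous)
      (fun r _ => Set.mem_iUnion.2 ⟨r, mem_interior_iff_mem_nhds.2 (hV r)⟩)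
  have claim : ∀ k : ℕ, P (γ 0) (γ (τ k)) (Path.Homotopic.Quotient.mk (γ.subpath 0 (τ k))) := by
    intro k
    induction k with
    | zero =>
      rw [h0, Path.subpath_self]
      exact hloc (hGM 0) (Path.refl (γ 0)) fun _ => mem_of_mem_nhds (hV 0)
    | succ k ih =>
      obtain ⟨c, hc⟩ := hsub k
      have hpiece : P _ _ (Path.Homotopic.Quotient.mk (γ.subpath (τ k) (τ (k + 1)))) := by
        refine hloc (hGM c) _ fun s => ?_
        have hs : γ.subpath (τ k) (τ (k + 1)) s ∈ Set.range (γ.subpath (τ k) (τ (k + 1))) := ⟨s, rfl⟩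
        rw [Path.range_subpath_of_le _ _ _ (hmono (Nat.le_succ k))] at hs
        obtain ⟨r, hr, hrs⟩ := hs
        rw [← hrs]
        exact interior_subset (hc hr)
      have heq : Path.Homotopic.Quotient.mk (γ.subpath 0 (τ (k + 1))) =
          (Path.Homotopic.Quotient.mk (γ.subpath 0 (τ k))).trans
            (Path.Homotopic.Quotient.mk (γ.subpath (τ k) (τ (k + 1)))) := by
        rw [← Path.Homotopic.Quotient.mk_trans]
        exact Path.Homotopic.Quotient.eq.2 ⟨(Path.Homotopy.subpathTransSubpath γ 0 (τ k) (τ (k + 1))).symm⟩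
      rw [heq]
      exact htrans _ _ ih hpiece
  have aux : ∀ {a b : ComplexPoints S} (q : Path.Homotopic.Quotient a b) {a' b' : ComplexPoints S}
      (ha : a' = a) (hb : b' = b), P a' b' (q.cast ha hb) → P a b q := by
    rintro a b q a' b' rfl rfl h
    simpa using h
  have h1 := claim m
  rw [hm m le_rfl, Path.subpath_zero_one, Path.Homotopic.Quotient.mk_cast] at h1
  exact aux _ γ.source γ.target h1

/-- **Rigidity: the conjugated transport is determined by topology.** If `D` is Gauss–Manin, any
transport `Φ` on the Betti cohomology of the fibres which is functorial for concatenation and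
carries `ξ|_{𝒳_t}` to `ξ|_{𝒳_{t'}}` along paths inside each set over which `D` is Gauss–Manin
coincides with `D.bettiTransport` on every path; applied to the transport of `Rⁱ f(ℂ)_* ℚ` (which has
this property over every open set, Voisin I §9.2.1): `(D.V, fiberIso)` is conjugate to the
Gauss–Manin system. [cite: VoisinHodgeII2003, §3.1.2] -/
theorem IsGaussManin.eq_bettiTransport (hD : D.IsGaussManin)
    (Φ : ∀ ⦃t t' : ComplexPoints S⦄, Path.Homotopic.Quotient t t' →
      bettiCohomology (fiberOver f t) i → bettiCohomology (fiberOver f t') i)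
    (htrans : ∀ ⦃t t' t'' : ComplexPoints S⦄ (γ₁ : Path.Homotopic.Quotient t t')
      (γ₂ : Path.Homotopic.Quotient t' t'') (x : bettiCohomology (fiberOver f t) i),
      Φ (γ₁.trans γ₂) x = Φ γ₂ (Φ γ₁ x))
    (hloc : ∀ ⦃V : Set (ComplexPoints S)⦄, D.IsGaussManinOn V → ∀ ⦃t t' : ComplexPoints S⦄
      (ht : t ∈ V) (ht' : t' ∈ V) (γ : Path t t'), (∀ τ, γ τ ∈ V) →
        ∀ ξ : singularCohomology ℚ ℚ (fiberTube f V) i,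
          Φ ⟦γ⟧ ((fiberTubeRestrict f ht i).hom ξ) = (fiberTubeRestrict f ht' i).hom ξ)
    {t t' : ComplexPoints S} (γ : Path t t') : Φ ⟦γ⟧ = D.bettiTransport ⟦γ⟧ := by
  refine hD.pathInduction (fun t t' q => Φ q = D.bettiTransport q) (fun γ₁ γ₂ h₁ h₂ => ?_)
    (fun V hV t t' δ hδ => ?_) γ
  · funext x
    rw [htrans, bettiTransport_trans, LinearMap.comp_apply, h₁, h₂]
  · have ht : t ∈ V := by simpa using hδ 0
    have ht' : t' ∈ V := by simpa using hδ 1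
    funext y
    obtain ⟨ξ, rfl⟩ := hV.surjective ht y
    rw [hloc hV ht ht' δ hδ ξ, hV.bettiTransport_fiberTubeRestrict ht ht' δ hδ ξ]

end GeometricVHSData

end Literature.AlgebraicGeometry.Motives
end
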